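import Summits.CriticalPhenomena.PercolationContinuityZ3.Theorems.PercNearOneGluingNoHeavyQuantHeavyShift
import Summits.CriticalPhenomena.PercolationContinuityZ3.Theorems.PercNearOneGluingNoHeavyQuantSliceClosure
import HarnessLib

/-!
# QUANT lane R8, T-DEC: a law whose only LOW atom is zero is HEAVY at floor `mean / top` — the two uniform regimes
# (`s ≤ 1`, `1 < s ≤ 2`) of the average-floor blob lemma, for EVERY width and EVERY law at once (prim-quant-census-2 gen 81)

builds on p205010 (kernel theorem, internal audit signed; external expert review pending)

Support file (`--supports stmt-CriticalPhenomena-4575`), QUANT lane census seat prim-quant-census-2 (gen 81); memo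
`run/shared/lean/prim/quant/prim-quant-census-2-g81/AFL-G81.md` §1.  Theorems only, standard axioms, no sorries, no definitions.

A HEAVY DECOMPOSITION of a law `μ` on `{0..M}` at floor `x` and target `T` (as in `…QuantHeavyShift`, written inline as an `∃`) is an
exact finite mixture of two-point components `{lo, hi; γ}` with `x ≤ γ` and credit `2·lo + (hi − lo)·γ ≥ T` (a point `lo = hi` needs
`T ≤ 2·lo`); it is DEC at EVERY layer (`decAtT_of_heavy`).  The regime lemmas of census-2 g80 (`heavy_fourAtoms_small/mid`,
`heavy_fiveAtoms_r1/r2`, `heavy_threeAtoms_r1/r2`: laws on `{0, k, 2k, …}` of blob mean `s·k` with `s ≤ 1` resp. `1 < s ≤ 2`) use only the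
mass and the mean of the law.  This file proves their common generalisation, with no bound on the number of atoms:

* **`heavy_of_zeroLow`** — ANY probability law `μ` on `{0..M}` with mean `T > 0` and NO atom `h` with `0 < h < T/2` (zero is the only low
  atom) carries a heavy decomposition at floor `T/M` and target `T`: the zero ships to every atom `h > T` through the mean-`T` pair
  `{0, h; T/h}` (gate `T/h ≥ T/M`, credit exactly `T`) with weight `κ·μ h·h`, `κ = μ 0 / U`, `U = Σ_{h > T} μ h·(h − T)`; every other
  charged atom `h` has `2h ≥ T` and keeps its leftover `μ h·(1 − κT)` as a self-sufficient point.  Capacity is the one-line moment identity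
  `U = T·μ 0 + Σ_{0 < h ≤ T} μ h·(T − h) ≥ T·μ 0` (mass `1`, mean `T`), i.e. `κT ≤ 1`.  The floor `T/M` is sharp (the pair into the top
  atom sits exactly at it).
* **`decAtT_of_zeroLow`** — hence `DECAtT (T/M) T j M μ` at every layer `j`.
* **`blobLaw_eq_zero_of_not_dvd`** — a blob list all of whose sizes are multiples of `k` has its law supported on multiples of `k`;
  **`heavy_blobLaw_of_mean_le_two`** — THE AVERAGE-FLOOR BLOB LEMMA FOR `s ≤ 2`, EVERY WIDTH, EVERY GATE VECTOR: for blobs of a common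
  size `k` with gates `g₁, …, g_n ∈ [0,1]` and `0 < Σ gᵢ ≤ 2`, the law `blobLaw l` of `k·(ξ₁ + ⋯ + ξ_n)` is heavy at floor
  `blobMean l / blobTop l = (Σ gᵢ)/n` (the AVERAGE gate) and target its mean `k·Σ gᵢ` (its smallest positive atom is `k ≥ (k·Σgᵢ)/2`).
  This is conjecture BLOB-AFL (memo `…/prim-quant-census-2-g80/TRIPLE-G80.md` §5) in the regime `s ≤ 2`, uniformly in the width `n`;
  the kernel had `n = 2, 3, 4` (`heavy_twoBlobs`, `heavy_threeBlobs`, `heavy_fourBlobs`, gates `(g,…,g,cg)` only).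

HONEST STATUS.  Tools; BLOB-AFL for `s > 2` is open beyond width 4 (census LP: 0 failures, `n ≤ 8`; the binomial is numerically the extremal
gate vector at fixed `(n, s)`); `SiblingStep`, `FarTreeRow` OPEN; RATE class (log\*) / honest sentence of `run/shared/lean/prim/quant/README.md`
unchanged.  [this work].  Nothing here is cited as a published result.  The gluing rows served [cite: KozmaNitzan2024, Conjecture 3 (p. 15)];
product measure [cite: Grimmett1999, §1.3 p. 10].
-/

noncomputable section

open scoped BigOperators

namespace Summit.CriticalPhenomena.PercolationContinuityZ3.Theorems
namespace Quant

open Finset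

/-- the two-point law `{lo, hi; g}` (as in `…QuantLawDEC`) -/
local notation3 "TP[" lo ", " hi ", " g ", " h "]" =>
  (g : ℝ) * (if (h : ℕ) = (hi : ℕ) then (1 : ℝ) else 0) + (1 - (g : ℝ)) * (if (h : ℕ) = (lo : ℕ) then (1 : ℝ) else 0)

namespace LawDec

/-! ### The moment identity behind the capacity -/

/-- **capacity of the atoms above the mean.**  For a probability law `μ ≥ 0` on `{0..M}` with mean `T ≥ 0`, the up-moment
`U = Σ_{h > T} μ h·(h − T)` dominates `T·μ 0` (indeed `U = T·μ 0 + Σ_{0<h≤T} μ h·(T − h)`). [this work] -/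
theorem upMoment_ge (M : ℕ) (μ : ℕ → ℝ) (T : ℝ) (hμ0 : ∀ h, 0 ≤ μ h)
    (hμ1 : ∑ h ∈ Finset.range (M + 1), μ h = 1) (hmean : ∑ h ∈ Finset.range (M + 1), (h : ℝ) * μ h = T) (hT0 : 0 ≤ T) :
    T * μ 0 ≤ ∑ h ∈ Finset.range (M + 1), (if T < (h : ℝ) then μ h * ((h : ℝ) - T) else 0) := by
  -- `U - V = Σ μ h (h - T) = 0` with `V = Σ_{h ≤ T} μ h (T - h) ≥ μ 0 · T`
  have hzero : ∑ h ∈ Finset.range (M + 1), μ h * ((h : ℝ) - T) = 0 := by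
    have e : ∀ h : ℕ, μ h * ((h : ℝ) - T) = (h : ℝ) * μ h - T * μ h := fun h => by ring
    simp_rw [e]
    rw [Finset.sum_sub_distrib, ← Finset.mul_sum, hmean, hμ1, mul_one, sub_self]
  have hsplit : ∀ h : ℕ, μ h * ((h : ℝ) - T)
      = (if T < (h : ℝ) then μ h * ((h : ℝ) - T) else 0) - (if T < (h : ℝ) then 0 else μ h * (T - (h : ℝ))) := by
    intro h
    split_ifs <;> ring
  rw [Finset.sum_congr rfl (fun h _ => hsplit h), Finset.sum_sub_distrib, sub_eq_zero] at hzero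
  rw [hzero]
  have hmem : (0 : ℕ) ∈ Finset.range (M + 1) := Finset.mem_range.2 (Nat.succ_pos M)
  have hterm : T * μ 0 = (if T < ((0 : ℕ) : ℝ) then 0 else μ 0 * (T - ((0 : ℕ) : ℝ))) := by
    rw [Nat.cast_zero, if_neg (not_lt.2 hT0)]; ring
  rw [hterm]
  refine Finset.single_le_sum (f := fun h : ℕ => if T < (h : ℝ) then (0 : ℝ) else μ h * (T - (h : ℝ))) (fun h _ => ?_) hmem
  show (0 : ℝ) ≤ (if T < (h : ℝ) then (0 : ℝ) else μ h * (T - (h : ℝ)))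
  split_ifs with hh
  · exact le_rfl
  · exact mul_nonneg (hμ0 h) (by linarith [not_lt.1 hh])

/-! ### The zero-only-low lemma -/

/-- **A LAW WHOSE ONLY LOW ATOM IS ZERO IS HEAVY AT FLOOR `mean / top`.**  Let `μ ≥ 0` be a probability law on `{0..M}` with mean `T > 0`
such that `μ h = 0` whenever `0 < h` and `2h < T`.  Then `μ` is an exact finite mixture of components `{lo, hi; γ}` with `γ ≥ T/M` and
credit `2·lo + (hi − lo)·γ ≥ T`: the pairs `{0, h; T/h}` (`h > T`, weight `κ·μ h·h`, `κ = μ 0/U`) and the points `h ≠ 0` (weight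
`μ h·(1 − κT·[h > T])`), `U` the up-moment of `upMoment_ge` (`κT ≤ 1`).  Covers every width of the average-floor blob lemma with blob
mean `≤ 2`. [this work] -/
theorem heavy_of_zeroLow (M : ℕ) (μ : ℕ → ℝ) (T : ℝ) (hμ0 : ∀ h, 0 ≤ μ h) (hμM : ∀ h, M < h → μ h = 0)
    (hμ1 : ∑ h ∈ Finset.range (M + 1), μ h = 1) (hmean : ∑ h ∈ Finset.range (M + 1), (h : ℝ) * μ h = T) (hT0 : 0 < T)
    (hlow : ∀ h : ℕ, 0 < h → 2 * (h : ℝ) < T → μ h = 0) :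
    ∃ (ι : Type) (_ : Fintype ι) (lam γ : ι → ℝ) (lo hi : ι → ℕ),
      (∀ i, 0 ≤ lam i) ∧ (∑ i, lam i = 1) ∧ (∀ i, 0 ≤ γ i ∧ γ i ≤ 1) ∧ (∀ i, lo i ≤ hi i) ∧ (∀ i, hi i ≤ M) ∧
      (∀ h, μ h = ∑ i, lam i * TP[lo i, hi i, γ i, h]) ∧
      (∀ i, 0 < lam i → T / M ≤ γ i ∧ T ≤ 2 * (lo i : ℝ) + ((hi i : ℝ) - lo i) * γ i) := by
  classical
  -- the up-moment and the rate `κ = μ 0 / U`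
  set U : ℝ := ∑ h ∈ Finset.range (M + 1), (if T < (h : ℝ) then μ h * ((h : ℝ) - T) else 0) with hU
  have hU0 : 0 ≤ U := Finset.sum_nonneg fun h _ => by
    split_ifs with hh
    · exact mul_nonneg (hμ0 h) (by linarith)
    · exact le_rfl
  have hUge : T * μ 0 ≤ U := upMoment_ge M μ T hμ0 hμ1 hmean hT0.le
  set κ : ℝ := μ 0 / U with hκ
  have hκ0 : 0 ≤ κ := div_nonneg (hμ0 0) hU0
  have hκU : κ * U = μ 0 := by
    rcases hU0.eq_or_lt with hz | hpos
    · -- `U = 0` forces `μ 0 = 0`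
      have hμ00 : μ 0 = 0 := by
        have : T * μ 0 ≤ 0 := by rw [hz]; exact hUge
        nlinarith [hμ0 0]
      rw [← hz, mul_zero, hμ00]
    · rw [hκ, div_mul_cancel₀ _ hpos.ne']
  have hκT : κ * T ≤ 1 := by
    rcases hU0.eq_or_lt with hz | hpos
    · have : κ = 0 := by rw [hκ, ← hz, div_zero]
      rw [this, zero_mul]; exact zero_le_one
    · rw [hκ, div_mul_eq_mul_div, div_le_one hpos, mul_comm]; exact hUge
  -- `T ≤ M` (the mean of a law on `{0..M}`)
  have hTM : T ≤ M := by
    rw [← hmean]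
    calc ∑ h ∈ Finset.range (M + 1), (h : ℝ) * μ h ≤ ∑ h ∈ Finset.range (M + 1), (M : ℝ) * μ h :=
          Finset.sum_le_sum fun h hh => mul_le_mul_of_nonneg_right
            (by exact_mod_cast Nat.lt_succ_iff.1 (Finset.mem_range.1 hh)) (hμ0 h)
      _ = M := by rw [← Finset.mul_sum, hμ1, mul_one]
  have hM0 : (0 : ℝ) < M := lt_of_lt_of_le hT0 hTM
  -- the weights, gates and atoms, as functions on `ℕ`
  let L1 : ℕ → ℝ := fun h => if T < (h : ℝ) then κ * μ h * h else 0
  let L2 : ℕ → ℝ := fun h => if h = 0 then 0 else μ h - (if T < (h : ℝ) then κ * T * μ h else 0)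
  let G1 : ℕ → ℝ := fun h => if T < (h : ℝ) then T / h else 1
  have hL1_0 : ∀ h, 0 ≤ L1 h := fun h => by
    simp only [L1]; split_ifs
    · exact mul_nonneg (mul_nonneg hκ0 (hμ0 h)) (Nat.cast_nonneg h)
    · exact le_rfl
  have hL2_0 : ∀ h, 0 ≤ L2 h := fun h => by
    simp only [L2]; split_ifs
    · exact le_rfl
    · have : κ * T * μ h ≤ 1 * μ h := mul_le_mul_of_nonneg_right hκT (hμ0 h)
      linarith
    · linarith [hμ0 h]
  have hG1 : ∀ h, 0 ≤ G1 h ∧ G1 h ≤ 1 := fun h => by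
    simp only [G1]; split_ifs with hh
    · have hh0 : (0 : ℝ) < h := hT0.trans hh
      exact ⟨div_nonneg hT0.le hh0.le, (div_le_one hh0).2 hh.le⟩
    · exact ⟨zero_le_one, le_rfl⟩
  -- termwise bookkeeping identities
  have hsumterm : ∀ h : ℕ, L1 h + L2 h = (if h = 0 then 0 else μ h) + κ * (if T < (h : ℝ) then μ h * ((h : ℝ) - T) else 0) := by
    intro h
    simp only [L1, L2]
    by_cases hT : T < (h : ℝ)
    · have hh0 : h ≠ 0 := by rintro rfl; rw [Nat.cast_zero] at hT; linarith
      rw [if_pos hT, if_pos hT, if_pos hT, if_neg hh0, if_neg hh0]; ring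
    · rw [if_neg hT, if_neg hT, if_neg hT]
      split_ifs <;> ring
  have hlowmass : ∀ h : ℕ, L1 h * (1 - G1 h) = κ * (if T < (h : ℝ) then μ h * ((h : ℝ) - T) else 0) := by
    intro h
    simp only [L1, G1]
    by_cases hT : T < (h : ℝ)
    · have hh0 : (h : ℝ) ≠ 0 := (hT0.trans hT).ne'
      rw [if_pos hT, if_pos hT, if_pos hT]
      field_simp
    · rw [if_neg hT, if_neg hT, if_neg hT]; ring
  have hhimass : ∀ h : ℕ, L1 h * G1 h + L2 h = (if h = 0 then 0 else μ h) := by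
    intro h
    simp only [L1, L2, G1]
    by_cases hT : T < (h : ℝ)
    · have hh0' : (h : ℝ) ≠ 0 := (hT0.trans hT).ne'
      have hh0 : h ≠ 0 := by rintro rfl; exact hh0' Nat.cast_zero
      rw [if_pos hT, if_pos hT, if_pos hT, if_neg hh0, if_neg hh0]
      field_simp
      ring
    · rw [if_neg hT, if_neg hT, if_neg hT]
      split_ifs <;> ring
  -- the law, atom by atom (computed on `ℕ`-indexed sums)
  have hlaw : ∀ h' : ℕ, μ h' = (∑ x : Fin (M + 1), L1 (x : ℕ) * TP[(0 : ℕ), (x : ℕ), G1 (x : ℕ), h'])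
      + ∑ x : Fin (M + 1), L2 (x : ℕ) * TP[(x : ℕ), (x : ℕ), (1 : ℝ), h'] := by
    intro h'
    rw [Fin.sum_univ_eq_sum_range (fun h => L1 h * TP[(0 : ℕ), h, G1 h, h']) (M + 1),
      Fin.sum_univ_eq_sum_range (fun h => L2 h * TP[h, h, (1 : ℝ), h']) (M + 1)]
    have e1 : ∀ h : ℕ, L1 h * TP[(0 : ℕ), h, G1 h, h']
        = (L1 h * G1 h) * (if h' = h then (1 : ℝ) else 0) + (if h' = 0 then (1 : ℝ) else 0) * (L1 h * (1 - G1 h)) := fun h => by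
      ring
    have e2 : ∀ h : ℕ, L2 h * TP[h, h, (1 : ℝ), h'] = L2 h * (if h' = h then (1 : ℝ) else 0) := fun h => by ring
    simp_rw [e1, e2]
    rw [Finset.sum_add_distrib, ← Finset.mul_sum, Finset.sum_congr rfl fun h _ => hlowmass h, ← Finset.mul_sum, hκU,
      Finset.sum_mul_boole, Finset.sum_mul_boole]
    by_cases hh' : h' ∈ Finset.range (M + 1)
    · rw [if_pos hh', if_pos hh', add_right_comm, hhimass h']
      by_cases h0 : h' = 0
      · rw [if_pos h0, if_pos h0, h0]; ring
      · rw [if_neg h0, if_neg h0]; ring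
    · have hMh : M < h' := by rw [Finset.mem_range] at hh'; omega
      rw [if_neg hh', if_neg hh', if_neg (by omega : h' ≠ 0), hμM h' hMh]; ring
  -- the decomposition, indexed by `Fin (M+1) ⊕ Fin (M+1)` (pairs `{0, h; T/h}`, points `h`)
  refine ⟨Fin (M + 1) ⊕ Fin (M + 1), inferInstance,
    Sum.elim (fun h => L1 h) (fun h => L2 h), Sum.elim (fun h => G1 h) (fun _ => 1),
    Sum.elim (fun _ => 0) (fun h => (h : ℕ)), Sum.elim (fun h => (h : ℕ)) (fun h => (h : ℕ)),
    ?_, ?_, ?_, ?_, ?_, fun h' => ?_, ?_⟩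
  · rintro (h | h)
    · exact hL1_0 h
    · exact hL2_0 h
  · -- total weight `= (1 - μ 0) + κ U = 1`
    rw [Fintype.sum_sum_type]
    dsimp only [Sum.elim_inl, Sum.elim_inr]
    rw [Fin.sum_univ_eq_sum_range (fun h => L1 h) (M + 1), Fin.sum_univ_eq_sum_range (fun h => L2 h) (M + 1),
      ← Finset.sum_add_distrib, Finset.sum_congr rfl fun h _ => hsumterm h, Finset.sum_add_distrib, ← Finset.mul_sum, hκU]
    have hpt : ∑ h ∈ Finset.range (M + 1), (if h = 0 then (0 : ℝ) else μ h) = 1 - μ 0 := by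
      have e : ∀ h : ℕ, (if h = 0 then (0 : ℝ) else μ h) = μ h - (if h = 0 then μ h else 0) := fun h => by
        split_ifs <;> ring
      simp_rw [e]
      rw [Finset.sum_sub_distrib, hμ1, Finset.sum_ite_eq' (Finset.range (M + 1)) 0 μ,
        if_pos (Finset.mem_range.2 (Nat.succ_pos M))]
    rw [hpt]; ring
  · rintro (h | h)
    · exact hG1 h
    · exact ⟨zero_le_one, le_rfl⟩
  · rintro (h | h)
    · exact Nat.zero_le _
    · exact le_rfl
  · rintro (h | h) <;> exact Nat.lt_succ_iff.1 h.isLt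
  · -- the law, atom by atom
    rw [Fintype.sum_sum_type]
    exact hlaw h'
  · -- gates `≥ T/M` and credits `≥ T` of the charged components
    rintro (h | h) hpos
    · simp only [Sum.elim_inl] at hpos ⊢
      have hT : T < ((h : ℕ) : ℝ) := by
        by_contra hT; simp only [L1, if_neg hT] at hpos; exact lt_irrefl _ hpos
      have hh0 : (0 : ℝ) < ((h : ℕ) : ℝ) := hT0.trans hT
      have hG : G1 h = T / ((h : ℕ) : ℝ) := by simp only [G1, if_pos hT]
      rw [hG]
      refine ⟨div_le_div_of_nonneg_left hT0.le hh0 (by exact_mod_cast Nat.lt_succ_iff.1 h.isLt), ?_⟩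
      rw [Nat.cast_zero, mul_zero, zero_add, sub_zero, mul_div_cancel₀ _ hh0.ne']
    · simp only [Sum.elim_inr] at hpos ⊢
      refine ⟨(div_le_one hM0).2 hTM, ?_⟩
      rw [sub_self, zero_mul, add_zero]
      -- a charged point is a charged atom `h ≠ 0`, hence not low
      have hh0 : (h : ℕ) ≠ 0 := by
        intro h0; simp only [L2, h0, if_true] at hpos; exact lt_irrefl _ hpos
      have hμpos : 0 < μ h := by
        by_contra hle
        have hz : μ h = 0 := le_antisymm (not_lt.1 hle) (hμ0 h)
        simp only [L2, if_neg hh0, hz, mul_zero, ite_self, sub_self] at hpos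
        exact lt_irrefl _ hpos
      by_contra hlt
      exact hμpos.ne' (hlow h (Nat.pos_of_ne_zero hh0) (not_le.1 hlt))

/-- **hence DEC at every layer, at floor `T/M` and target `T`.** [this work] -/
theorem decAtT_of_zeroLow (M : ℕ) (μ : ℕ → ℝ) (T : ℝ) (hμ0 : ∀ h, 0 ≤ μ h) (hμM : ∀ h, M < h → μ h = 0)
    (hμ1 : ∑ h ∈ Finset.range (M + 1), μ h = 1) (hmean : ∑ h ∈ Finset.range (M + 1), (h : ℝ) * μ h = T) (hT0 : 0 < T)
    (hlow : ∀ h : ℕ, 0 < h → 2 * (h : ℝ) < T → μ h = 0) (j : ℕ) :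
    DECAtT (T / M) T j M μ :=
  decAtT_of_heavy (T / M) T M μ (heavy_of_zeroLow M μ T hμ0 hμM hμ1 hmean hT0 hlow) j

/-! ### Blobs of a common size: the average-floor blob lemma for blob mean `≤ 2`, every width -/

/-- **a blob list whose sizes are multiples of `k` has its law on the multiples of `k`.** [this work] -/
theorem blobLaw_eq_zero_of_not_dvd (k : ℕ) :
    ∀ l : List (ℕ × ℝ), (∀ p ∈ l, k ∣ p.1) → ∀ h : ℕ, ¬ k ∣ h → blobLaw l h = 0
  | [], _, h, hh => by
    simp only [blobLaw]
    rw [if_neg]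
    rintro rfl
    exact hh (dvd_zero k)
  | p :: l, hl, h, hh => by
    have hl' : ∀ p' ∈ l, k ∣ p'.1 := fun p' hp' => hl p' (List.mem_cons_of_mem p hp')
    have hp : k ∣ p.1 := hl p List.mem_cons_self
    simp only [blobLaw, slice]
    rw [blobLaw_eq_zero_of_not_dvd k l hl' h hh, mul_zero, zero_add]
    split_ifs with ha
    · rw [blobLaw_eq_zero_of_not_dvd k l hl' (h - p.1) (fun hd => hh ?_), mul_zero]
      have : h = (h - p.1) + p.1 := (Nat.sub_add_cancel ha).symm
      rw [this]
      exact dvd_add hd hp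
    · rw [mul_zero]

/-- **THE AVERAGE-FLOOR BLOB LEMMA FOR BLOB MEAN `≤ 2`, EVERY WIDTH AND EVERY GATE VECTOR** (conjecture BLOB-AFL of
`TRIPLE-G80.md` §5 in the regimes `s ≤ 1`, `1 < s ≤ 2`, uniformly in `n`).  For a blob list `l` with all sizes equal to `k` and
gates in `[0,1]` (`n = |l|` blobs, `blobTop l = k·n`, `blobMean l = k·Σgᵢ`), if `0 < blobMean l ≤ 2k` (i.e. `0 < Σ gᵢ ≤ 2`) then
`blobLaw l` is heavy at floor `blobMean l / blobTop l = (Σ gᵢ)/n` — the AVERAGE gate — and target `blobMean l`: its only low atom is `0`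
(`heavy_of_zeroLow`; the charged atoms are multiples of `k ≥ blobMean l / 2`). [this work] -/
theorem heavy_blobLaw_of_mean_le_two (k : ℕ) (l : List (ℕ × ℝ)) (hl : ∀ p ∈ l, p.1 = k ∧ 0 ≤ p.2 ∧ p.2 ≤ 1)
    (hm0 : 0 < blobMean l) (hm2 : blobMean l ≤ 2 * k) :
    ∃ (ι : Type) (_ : Fintype ι) (lam γ : ι → ℝ) (lo hi : ι → ℕ),
      (∀ i, 0 ≤ lam i) ∧ (∑ i, lam i = 1) ∧ (∀ i, 0 ≤ γ i ∧ γ i ≤ 1) ∧ (∀ i, lo i ≤ hi i) ∧ (∀ i, hi i ≤ blobTop l) ∧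
      (∀ h, blobLaw l h = ∑ i, lam i * TP[lo i, hi i, γ i, h]) ∧
      (∀ i, 0 < lam i → blobMean l / blobTop l ≤ γ i ∧ blobMean l ≤ 2 * (lo i : ℝ) + ((hi i : ℝ) - lo i) * γ i) :=
  heavy_of_zeroLow (blobTop l) (blobLaw l) (blobMean l) (blobLaw_nonneg l fun p hp => (hl p hp).2)
    (fun h hh => blobLaw_eq_zero l h hh) (sum_blobLaw l) (sum_mul_blobLaw l) hm0
    (fun h hh0 hhT => blobLaw_eq_zero_of_not_dvd k l (fun p hp => by rw [(hl p hp).1]) h (fun hd => by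
      have hkh : k ≤ h := Nat.le_of_dvd hh0 hd
      have : (k : ℝ) ≤ h := by exact_mod_cast hkh
      linarith))

/-- **hence DEC at every layer** for such blob lists, at the average gate and the mean. [this work] -/
theorem decAtT_blobLaw_of_mean_le_two (k : ℕ) (l : List (ℕ × ℝ)) (hl : ∀ p ∈ l, p.1 = k ∧ 0 ≤ p.2 ∧ p.2 ≤ 1)
    (hm0 : 0 < blobMean l) (hm2 : blobMean l ≤ 2 * k) (j : ℕ) :
    DECAtT (blobMean l / blobTop l) (blobMean l) j (blobTop l) (blobLaw l) :=
  decAtT_of_heavy _ _ _ _ (heavy_blobLaw_of_mean_le_two k l hl hm0 hm2) j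

end LawDec
end Quant
end Summit.CriticalPhenomena.PercolationContinuityZ3.Theorems
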